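import Summits.AtomisticToContinuum.Crystallization.Theorems.FrustratedLawDichotomyStrainedPatchHomLeafTableParamC

/-!
# Param-form fcc table leaf — ★★★ SOUNDNESS of `leafCheckP` (assembly against hand-2's `leaf_sound_points_param`)

decomp-a2c hand-1 g23 (crux `AperiodicFrustratedLawGap`, stmt-AtomisticToContinuum-27623; critic row 882).  ★★★ `leafCheckP_sound`: if the table is
certified (`tab.allOK E ∨ tab.allOKK E P`), the label records are consistent, lie in `[−7,7]³∖0`, are canonical and pairwise distinct, have class sums
`≤ Aⱼ` and `n`-class sums `≤ ANd / ANo`, the floored Gram centre of the ENTRY box `(c, w)` is non-negative (`cenOKP c`), and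
`leafCheckP tab labs E A… ANd ANo nstop (gbP c w).toLK (epOf c w) sμ aμ = true`, then for every `U` whose ENTRIES lie in the box and for which every box
label not represented (up to sign) is far and every list label beyond the stop is far: `±aμ/SC ≤ Σ_{b ∈ [−7,7]³∖0} W₄₅ ‖latPt U fccVec b‖`.
The proof instantiates `…HomLeafPointsParam.leaf_sound_points_param` with `n = q = 9`, Gram centre `cG/SC`, the EXACT Jacobian `Jf`, remainders
`rhoP/SC`, and the kernel radius `radP ≥ r_v` (`rv_le`); the tail (far labels, half-set doubling) is hand-1 g20's verbatim with `far_of_farBP`.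
(The fcc corollary with far labels from `‖U − 1‖ ≤ 1/4` is `…HomEntryTableP.leafCheckP_sound_fcc`.)  DEF-FREE; 0 sorry; standard axioms.
`--supports stmt-AtomisticToContinuum-27623`.
-/

noncomputable section

namespace Summit.AtomisticToContinuum.Crystallization.Theorems.FrustratedLawDichotomyStrainedPatchHomLeafTableCheck

open scoped BigOperators RealInnerProductSpace
open Set
open Literature.Analysis.ValidatedNumerics.Numerics
open Summit.AtomisticToContinuum.Crystallization.Theorems.ChargedEnergyGapNegative (E3)
open Summit.AtomisticToContinuum.Crystallization.Theorems.FrustratedLawDichotomySchurCut (effPot w₄₅ ω₄)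
open Summit.AtomisticToContinuum.Crystallization.Theorems.FrustratedLawDichotomyStrainedPatchHomSplit (latPt)
open Summit.AtomisticToContinuum.Crystallization.Theorems.FrustratedLawDichotomyStrainedPatchHomGram (summand_eq_gram norm_sq_latPt_eq_sum_gram)
open Summit.AtomisticToContinuum.Crystallization.Theorems.FrustratedLawDichotomyStrainedPatchHomTermCalculus (hasDerivAt_phi45 effPot45_eq_far)
open Summit.AtomisticToContinuum.Crystallization.Theorems.FrustratedLawDichotomyStrainedPatchHomLeafPoints
open Summit.AtomisticToContinuum.Crystallization.Theorems.FrustratedLawDichotomyStrainedPatchHomLeafPointsParam (leaf_sound_points_param)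
open Literature.Barriers.AtomisticToContinuum.FlatleyTheil2015 (fccVec)

/-! ## ★★★ Soundness of the param-form leaf check -/

/-- ★★★ **SOUNDNESS OF THE PARAM-FORM LEAF CHECK.**  See the module docstring. [folklore] -/
theorem leafCheckP_sound {tab : QT} {P : ℕ} {labs : List NL} {E A0 A1 A2 A3 A4 A5 ANd ANo nstop : ℕ} {c w : Fin 3 × Fin 3 → ℤ}
    {sμ : Bool} {aμ : ℕ}
    (htab : tab.allOK E = true ∨ tab.allOKK E P = true) (hok : ∀ l ∈ labs, l.ok = true)
    (hbox7 : ∀ l ∈ labs, l.toLab ∈ (Fintype.piFinset fun _ : Fin 3 => Finset.Icc (-7 : ℤ) 7).filter (fun b => b ≠ 0))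
    (hcanon : ∀ l ∈ labs, ∀ l' ∈ labs, l.toLab ≠ -l'.toLab) (hnd : (labs.map NL.toLab).Nodup)
    (hA : (labs.map NL.m00).sum ≤ A0 ∧ (labs.map NL.m11).sum ≤ A1 ∧ (labs.map NL.m22).sum ≤ A2 ∧ (labs.map NL.m01).sum ≤ A3 ∧
      (labs.map NL.m02).sum ≤ A4 ∧ (labs.map NL.m12).sum ≤ A5)
    (hAN : ∀ cc bb : Fin 3, (labs.map (fun l => (nZ l cc * nZ l bb).natAbs)).sum ≤ ANt ANd ANo cc bb)
    (hcen : cenOKP c = true)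
    (h : leafCheckP tab labs E A0 A1 A2 A3 A4 A5 ANd ANo nstop (gbP c w).toLK (epOf c w) sμ aμ = true) (U : E3 →L[ℝ] E3)
    (hbox : ∀ ab : Fin 3 × Fin 3, |(U (EuclideanSpace.single ab.2 (1 : ℝ))) ab.1 - (c ab : ℝ) / SC| ≤ (w ab : ℝ) / SC)
    (hcov : ∀ b ∈ (Fintype.piFinset fun _ : Fin 3 => Finset.Icc (-7 : ℤ) 7).filter (fun b => b ≠ 0),
      (∃ l ∈ labs, l.toLab = b ∨ l.toLab = -b) ∨ 9 / 2 ≤ ‖latPt U fccVec b‖)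
    (hstop : ∀ l ∈ labs, l ∉ visited nstop labs → 9 / 2 ≤ ‖latPt U fccVec l.toLab‖) :
    ((sgnZ sμ aμ : ℤ) : ℝ) / SC ≤
      ∑ b ∈ (Fintype.piFinset fun _ : Fin 3 => Finset.Icc (-7 : ℤ) 7).filter (fun b => b ≠ 0), effPot w₄₅ ω₄ (3 / 400) ‖latPt U fccVec b‖ := by
  classical
  have hS := SC_pos
  have hw := w_nonneg_of_hbox hbox
  unfold leafCheckP at h
  obtain ⟨hokA, hle⟩ := finalP_true h
  set g := gbP c w with hg
  set k := g.toLK with hk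
  set e := epOf c w with he_def
  set r := radP k e with hr
  obtain ⟨hall, eV, eD, eS, e0, e1, e2, e3, e4, e5, eC⟩ := acc_sumsR hokA
  set a := foldNLR tab k r nstop acc0 labs with ha
  set T := (visited nstop labs).filter (fun l => treatedR tab k r l) with hT
  have hTsub : T.Sublist labs := List.filter_sublist.trans (visited_sublist nstop labs)
  have hTmem : ∀ l ∈ T, l ∈ labs := fun l hl => hTsub.subset hl
  have hTt : ∀ l ∈ T, treatedR tab k r l = true := fun l hl => (List.mem_filter.1 hl).2
  have hTnd : T.Nodup := (hnd.of_map _).sublist hTsub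
  have hTok : ∀ l ∈ T, l.ok = true := fun l hl => hok l (hTmem l hl)
  set S : Finset NL := T.toFinset with hSdef
  have hmemS : ∀ l, l ∈ S ↔ l ∈ T := fun l => List.mem_toFinset
  -- per-record facts for treated labels
  have hF : ∀ l ∈ S, qNeg k l + r l ≤ qPos k l ∧ (rowT tab k l).A ≤ q0N k l - r l ∧ q0N k l + r l ≤ (rowT tab k l).B ∧
      (rowT tab k l).t ≤ q0N k l ∧ ((rowT tab k l).ok E = true ∨ (rowT tab k l).okK E P = true) :=
    fun l hl => treated_factsR htab (hTt l ((hmemS l).1 hl))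
  -- real data
  let Lf : NL → Fin 9 → ℝ := fun l k9 => (l.toLab ((@finProdFinEquiv 3 3).symm k9).1 : ℝ) * (l.toLab ((@finProdFinEquiv 3 3).symm k9).2 : ℝ)
  let c0f : Fin 9 → ℝ := fun k9 => ((g.cz ((@finProdFinEquiv 3 3).symm k9).1 ((@finProdFinEquiv 3 3).symm k9).2 : ℤ) : ℝ) / SC
  let ρf : Fin 9 → ℝ := fun k9 => (((g.wz ((@finProdFinEquiv 3 3).symm k9).1 ((@finProdFinEquiv 3 3).symm k9).2 : ℕ) : ℤ) : ℝ) / SC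
  let cf : Fin 9 → ℝ := fun k9 => ⟪U (fccVec ((@finProdFinEquiv 3 3).symm k9).1), U (fccVec ((@finProdFinEquiv 3 3).symm k9).2)⟫
  let Jf9 : Fin 9 → Fin 9 → ℝ := fun k9' k9 => Jf (OfR (fun ab => (c ab : ℝ) / SC)) ((@finProdFinEquiv 3 3).symm k9') ((@finProdFinEquiv 3 3).symm k9)
  let hw9 : Fin 9 → ℝ := fun k9' => (w ((@finProdFinEquiv 3 3).symm k9') : ℝ) / SC
  let u9 : Fin 9 → ℝ := fun k9' => uE U ((@finProdFinEquiv 3 3).symm k9') - (c ((@finProdFinEquiv 3 3).symm k9') : ℝ) / SC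
  -- δ in ℕ is exact
  have hdlt : ∀ l ∈ S, (((dlt tab k l : ℕ) : ℤ) : ℝ) = ((((qPos k l : ℕ) : ℤ) - ((qNeg k l : ℕ) : ℤ) : ℤ) : ℝ) - (((rowT tab k l).t : ℤ) : ℝ) := by
    intro l hl
    obtain ⟨h1, -, -, h4, -⟩ := hF l hl
    have hq : qNeg k l ≤ qPos k l := le_trans (Nat.le_add_right _ _) h1
    unfold dlt q0N
    have e : ((qPos k l - qNeg k l - (rowT tab k l).t : ℕ) : ℤ) = (qPos k l : ℤ) - (qNeg k l : ℤ) - ((rowT tab k l).t : ℤ) := by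
      unfold q0N at h4; omega
    exact_mod_cast e
  have hell0 : ∀ l ∈ S, ∑ k9, Lf l k9 * c0f k9 = ((((qPos k l : ℕ) : ℤ) - ((qNeg k l : ℕ) : ℤ) : ℤ) : ℝ) / SC :=
    fun l hl => ell0_eq (hTok l ((hmemS l).1 hl)) g
  -- the theorem's radius is dominated by the kernel radius
  have hrv : ∀ l ∈ S, ∑ k9', |∑ k9, Lf l k9 * Jf9 k9' k9| * hw9 k9' + ∑ k9, |Lf l k9| * ρf k9 ≤ (((r l : ℕ) : ℤ) : ℝ) / SC := by
    intro l hl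
    have := rv_le (c := c) hw (hTok l ((hmemS l).1 hl))
    push_cast at this ⊢
    exact this
  have hrv0 : ∀ l ∈ S, 0 ≤ ∑ k9', |∑ k9, Lf l k9 * Jf9 k9' k9| * hw9 k9' + ∑ k9, |Lf l k9| * ρf k9 := by
    intro l _
    refine add_nonneg (Finset.sum_nonneg fun k9' _ => mul_nonneg (abs_nonneg _) (div_nonneg (by exact_mod_cast hw _) hS.le))
      (Finset.sum_nonneg fun k9 _ => mul_nonneg (abs_nonneg _) (div_nonneg (by exact_mod_cast Int.natCast_nonneg _) hS.le))
  -- row semantics for treated labels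
  have RS : ∀ l ∈ S, _ := fun l hl => (hF l hl).2.2.2.2.elim (fun h => Row.ok_sound h) (fun h => Row.okK_sound h)
  -- the points-form bound over S
  have hmain := leaf_sound_points_param S Lf (fun _ q => effPot w₄₅ ω₄ (3 / 400) (Real.sqrt q))
    (fun _ t => deriv (effPot w₄₅ ω₄ (3 / 400)) (Real.sqrt t) / (2 * Real.sqrt t))
    (fun l => (((rowT tab k l).A : ℤ) : ℝ) / SC) (fun l => (((rowT tab k l).B : ℤ) : ℝ) / SC) (fun l => (((rowT tab k l).M : ℤ) : ℝ) / SC)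
    (fun l => (((rowT tab k l).t : ℤ) : ℝ) / SC) (fun l => ((sgnZ (rowT tab k l).sV (rowT tab k l).aV : ℤ) : ℝ) / SC)
    (fun l => ((sgnZ (rowT tab k l).sD (rowT tab k l).aD - (E : ℤ) : ℤ) : ℝ) / SC)
    (fun l => ((sgnZ (rowT tab k l).sD (rowT tab k l).aD + (E : ℤ) : ℤ) : ℝ) / SC) c0f Jf9 hw9 ρf
    (((sgnZ sμ aμ : ℤ) : ℝ) / SC / 2)
    (fun k9' => div_nonneg (by exact_mod_cast hw _) hS.le)
    (fun k9 => div_nonneg (by exact_mod_cast Int.natCast_nonneg _) hS.le)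
    (fun l hl => (RS l hl).2.2.1)
    (fun l hl t ht => hasDerivAt_phi45 (lt_of_lt_of_le (div_pos (by exact_mod_cast (RS l hl).2.2.2.2.1) hS) ht.1))
    (fun l hl => (RS l hl).2.2.2.1)
    (fun l hl => ⟨div_le_div_of_nonneg_right (by exact_mod_cast (RS l hl).2.2.2.2.2.1) hS.le,
      div_le_div_of_nonneg_right (by exact_mod_cast (RS l hl).2.2.2.2.2.2) hS.le⟩)
    ?hlo ?hhi (fun l hl => (RS l hl).1) (fun l hl => (RS l hl).2.1) ?hcheck cf u9 (fun k9' => hbox _) ?he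
  case hlo =>
    intro l hl
    rw [hell0 l hl]
    obtain ⟨h1, h2, -, -, -⟩ := hF l hl
    have hq : qNeg k l ≤ qPos k l := le_trans (Nat.le_add_right _ _) h1
    have : ((rowT tab k l).A : ℤ) ≤ (qPos k l : ℤ) - qNeg k l - r l := by unfold q0N at h2; omega
    have hA : (((rowT tab k l).A : ℤ) : ℝ) / SC ≤ ((((qPos k l : ℕ) : ℤ) - ((qNeg k l : ℕ) : ℤ) : ℤ) : ℝ) / SC - (((r l : ℕ) : ℤ) : ℝ) / SC := by
      rw [← sub_div]; refine div_le_div_of_nonneg_right ?_ hS.le; exact_mod_cast this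
    linarith [hrv l hl]
  case hhi =>
    intro l hl
    rw [hell0 l hl]
    obtain ⟨h1, -, h3, -, -⟩ := hF l hl
    have hq : qNeg k l ≤ qPos k l := le_trans (Nat.le_add_right _ _) h1
    have : (qPos k l : ℤ) - qNeg k l + r l ≤ ((rowT tab k l).B : ℤ) := by unfold q0N at h3; omega
    have hB : ((((qPos k l : ℕ) : ℤ) - ((qNeg k l : ℕ) : ℤ) : ℤ) : ℝ) / SC + (((r l : ℕ) : ℤ) : ℝ) / SC ≤ (((rowT tab k l).B : ℤ) : ℝ) / SC := by
      rw [← add_div]; refine div_le_div_of_nonneg_right ?_ hS.le; exact_mod_cast this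
    linarith [hrv l hl]
  case he =>
    intro k9
    have hc0 : c0f k9 = ((cG c ((@finProdFinEquiv 3 3).symm k9).1 ((@finProdFinEquiv 3 3).symm k9).2 : ℤ) : ℝ) / SC := by
      show ((g.cz _ _ : ℤ) : ℝ) / SC = _; rw [hg, gbP_cz_cast w hcen]
    have hρ : ρf k9 = ((rhoP w ((@finProdFinEquiv 3 3).symm k9).1 ((@finProdFinEquiv 3 3).symm k9).2 : ℕ) : ℝ) / SC := by
      show (((g.wz _ _ : ℕ) : ℤ) : ℝ) / SC = _; rw [hg, (gbP_wz_cz c w _ _).1]; push_cast; rfl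
    have hg' := gram_paramP U hbox ((@finProdFinEquiv 3 3).symm k9).1 ((@finProdFinEquiv 3 3).symm k9).2
    rw [hc0, hρ]
    rw [sum_fin9 (fun aa bb => Jf (OfR (fun ab => (c ab : ℝ) / SC)) (aa, bb) (((@finProdFinEquiv 3 3).symm k9).1, ((@finProdFinEquiv 3 3).symm k9).2) *
      (uE U (aa, bb) - (c (aa, bb) : ℝ) / SC))]
    exact hg'
  case hcheck =>
    -- δ' = ℓ₀ − p = dlt/SC ≥ 0
    have hδ : ∀ l ∈ S, ∑ k9, Lf l k9 * c0f k9 - (((rowT tab k l).t : ℤ) : ℝ) / SC = (((dlt tab k l : ℕ) : ℤ) : ℝ) / SC := by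
      intro l hl; rw [hell0 l hl, hdlt l hl, sub_div]
    have hδ0 : ∀ l ∈ S, (0:ℝ) ≤ (((dlt tab k l : ℕ) : ℤ) : ℝ) / SC := fun l _ => div_nonneg (by exact_mod_cast Nat.zero_le _) hS.le
    -- (i) values
    have hSV : ∑ l ∈ S, ((sgnZ (rowT tab k l).sV (rowT tab k l).aV : ℤ) : ℝ) / SC = ((((a.vP : ℕ) : ℤ) - ((a.vN : ℕ) : ℤ) : ℤ) : ℝ) / SC := by
      rw [← Finset.sum_div, hSdef, List.sum_toFinset _ hTnd, cast_list_sum_int, ← eV]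
    -- (ii) centre corrections
    have hSD : ∑ l ∈ S, min ((((sgnZ (rowT tab k l).sD (rowT tab k l).aD - (E : ℤ) : ℤ) : ℝ) / SC) *
          (∑ k9, Lf l k9 * c0f k9 - (((rowT tab k l).t : ℤ) : ℝ) / SC))
        ((((sgnZ (rowT tab k l).sD (rowT tab k l).aD + (E : ℤ) : ℤ) : ℝ) / SC) * (∑ k9, Lf l k9 * c0f k9 - (((rowT tab k l).t : ℤ) : ℝ) / SC)) =
        (((((a.dP : ℕ) : ℤ) - ((a.dN : ℕ) : ℤ) : ℤ) : ℝ) - (E : ℝ) * ((a.sd : ℕ) : ℝ)) / SC ^ 2 := by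
      have hterm : ∀ l ∈ S, min ((((sgnZ (rowT tab k l).sD (rowT tab k l).aD - (E : ℤ) : ℤ) : ℝ) / SC) *
          (∑ k9, Lf l k9 * c0f k9 - (((rowT tab k l).t : ℤ) : ℝ) / SC))
          ((((sgnZ (rowT tab k l).sD (rowT tab k l).aD + (E : ℤ) : ℤ) : ℝ) / SC) * (∑ k9, Lf l k9 * c0f k9 - (((rowT tab k l).t : ℤ) : ℝ) / SC)) =
          (((sgnZ (rowT tab k l).sD (rowT tab k l).aD * (dlt tab k l : ℤ) : ℤ) : ℝ) - (E : ℝ) * ((dlt tab k l : ℕ) : ℝ)) / SC ^ 2 := by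
        intro l hl
        rw [hδ l hl, min_eq_left (mul_le_mul_of_nonneg_right (div_le_div_of_nonneg_right (by push_cast; linarith) hS.le) (hδ0 l hl))]
        push_cast; field_simp
      rw [Finset.sum_congr rfl hterm, ← Finset.sum_div, Finset.sum_sub_distrib, ← Finset.mul_sum, hSdef, List.sum_toFinset _ hTnd,
        List.sum_toFinset _ hTnd, cast_list_sum_int, cast_list_sum_nat, ← eD, ← eS]
    -- (iv) curvature: r_v ≤ R, monotone
    have hSC : ∑ l ∈ S, (((rowT tab k l).M : ℤ) : ℝ) / SC * (|∑ k9, Lf l k9 * c0f k9 - (((rowT tab k l).t : ℤ) : ℝ) / SC| +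
        (∑ k9', |∑ k9, Lf l k9 * Jf9 k9' k9| * hw9 k9' + ∑ k9, |Lf l k9| * ρf k9)) ^ 2 ≤ ((a.cur : ℕ) : ℝ) / SC ^ 3 := by
      have hterm : ∀ l ∈ S, (((rowT tab k l).M : ℤ) : ℝ) / SC * (|∑ k9, Lf l k9 * c0f k9 - (((rowT tab k l).t : ℤ) : ℝ) / SC| +
          (∑ k9', |∑ k9, Lf l k9 * Jf9 k9' k9| * hw9 k9' + ∑ k9, |Lf l k9| * ρf k9)) ^ 2 ≤
          (((rowT tab k l).M * ((dlt tab k l + r l) * (dlt tab k l + r l)) : ℕ) : ℝ) / SC ^ 3 := by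
        intro l hl
        rw [hδ l hl, abs_of_nonneg (hδ0 l hl)]
        have hM0 : (0 : ℝ) ≤ (((rowT tab k l).M : ℤ) : ℝ) / SC := (RS l hl).2.2.1
        have hx0 : (0 : ℝ) ≤ (((dlt tab k l : ℕ) : ℤ) : ℝ) / SC + (∑ k9', |∑ k9, Lf l k9 * Jf9 k9' k9| * hw9 k9' + ∑ k9, |Lf l k9| * ρf k9) :=
          add_nonneg (hδ0 l hl) (hrv0 l hl)
        have hxy : (((dlt tab k l : ℕ) : ℤ) : ℝ) / SC + (∑ k9', |∑ k9, Lf l k9 * Jf9 k9' k9| * hw9 k9' + ∑ k9, |Lf l k9| * ρf k9) ≤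
            (((dlt tab k l : ℕ) : ℤ) : ℝ) / SC + (((r l : ℕ) : ℤ) : ℝ) / SC := by linarith [hrv l hl]
        have hsq := pow_le_pow_left₀ hx0 hxy 2
        have := mul_le_mul_of_nonneg_left hsq hM0
        refine this.trans (le_of_eq ?_)
        push_cast; field_simp
      refine (Finset.sum_le_sum hterm).trans (le_of_eq ?_)
      rw [← Finset.sum_div, hSdef, List.sum_toFinset _ hTnd, cast_list_sum_nat, ← eC]
    -- (iii-a) remainder classes (the nine Gram coordinates against ρ): verbatim the v2 class bounds with `wz = rhoP`
    have hsub : ∀ (m : NL → ℕ), (T.map m).sum ≤ (labs.map m).sum := fun m => (hTsub.map m).sum_le_sum (fun _ _ => Nat.zero_le _)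
    have hLc : ∀ l ∈ T, ∀ i j : Fin 3, (l.toLab i : ℝ) * (l.toLab j : ℝ) =
        ((( ![![(l.m00 : ℤ), sgnZ l.s01 l.m01, sgnZ l.s02 l.m02], ![sgnZ l.s01 l.m01, (l.m11 : ℤ), sgnZ l.s12 l.m12],
          ![sgnZ l.s02 l.m02, sgnZ l.s12 l.m12, (l.m22 : ℤ)]] i j : ℤ)) : ℝ) := by
      intro l hl i j; rw [← lab_mul_eq (hTok l hl)]; push_cast; rfl
    have c00 := class_bound (tab := tab) (k := k) (E := E) T hTnd (fun l => (l.toLab 0 : ℝ) * (l.toLab 0 : ℝ)) (fun l => (l.m00 : ℤ)) NL.m00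
      a.g0P a.g0N A0 (fun l hl => by rw [hLc l hl]; simp) (fun l => by simp) e0 ((hsub _).trans hA.1)
    have c11 := class_bound (tab := tab) (k := k) (E := E) T hTnd (fun l => (l.toLab 1 : ℝ) * (l.toLab 1 : ℝ)) (fun l => (l.m11 : ℤ)) NL.m11
      a.g1P a.g1N A1 (fun l hl => by rw [hLc l hl]; simp) (fun l => by simp) e1 ((hsub _).trans hA.2.1)
    have c22 := class_bound (tab := tab) (k := k) (E := E) T hTnd (fun l => (l.toLab 2 : ℝ) * (l.toLab 2 : ℝ)) (fun l => (l.m22 : ℤ)) NL.m22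
      a.g2P a.g2N A2 (fun l hl => by rw [hLc l hl]; simp) (fun l => by simp) e2 ((hsub _).trans hA.2.2.1)
    have c01 := class_bound (tab := tab) (k := k) (E := E) T hTnd (fun l => (l.toLab 0 : ℝ) * (l.toLab 1 : ℝ)) (fun l => sgnZ l.s01 l.m01) NL.m01
      a.g3P a.g3N A3 (fun l hl => by rw [hLc l hl]; simp) (fun l => abs_sgnZ _ _) e3 ((hsub _).trans hA.2.2.2.1)
    have c10 := class_bound (tab := tab) (k := k) (E := E) T hTnd (fun l => (l.toLab 1 : ℝ) * (l.toLab 0 : ℝ)) (fun l => sgnZ l.s01 l.m01) NL.m01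
      a.g3P a.g3N A3 (fun l hl => by rw [hLc l hl]; simp) (fun l => abs_sgnZ _ _) e3 ((hsub _).trans hA.2.2.2.1)
    have c02 := class_bound (tab := tab) (k := k) (E := E) T hTnd (fun l => (l.toLab 0 : ℝ) * (l.toLab 2 : ℝ)) (fun l => sgnZ l.s02 l.m02) NL.m02
      a.g4P a.g4N A4 (fun l hl => by rw [hLc l hl]; simp) (fun l => abs_sgnZ _ _) e4 ((hsub _).trans hA.2.2.2.2.1)
    have c20 := class_bound (tab := tab) (k := k) (E := E) T hTnd (fun l => (l.toLab 2 : ℝ) * (l.toLab 0 : ℝ)) (fun l => sgnZ l.s02 l.m02) NL.m02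
      a.g4P a.g4N A4 (fun l hl => by rw [hLc l hl]; simp) (fun l => abs_sgnZ _ _) e4 ((hsub _).trans hA.2.2.2.2.1)
    have c12 := class_bound (tab := tab) (k := k) (E := E) T hTnd (fun l => (l.toLab 1 : ℝ) * (l.toLab 2 : ℝ)) (fun l => sgnZ l.s12 l.m12) NL.m12
      a.g5P a.g5N A5 (fun l hl => by rw [hLc l hl]; simp) (fun l => abs_sgnZ _ _) e5 ((hsub _).trans hA.2.2.2.2.2)
    have c21 := class_bound (tab := tab) (k := k) (E := E) T hTnd (fun l => (l.toLab 2 : ℝ) * (l.toLab 1 : ℝ)) (fun l => sgnZ l.s12 l.m12) NL.m12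
      a.g5P a.g5N A5 (fun l hl => by rw [hLc l hl]; simp) (fun l => abs_sgnZ _ _) e5 ((hsub _).trans hA.2.2.2.2.2)
    have hw0 : ∀ i j : Fin 3, (0:ℝ) ≤ (((g.wz i j : ℕ) : ℤ) : ℝ) / SC := fun i j => div_nonneg (by exact_mod_cast Int.natCast_nonneg _) hS.le
    have hSG : ∑ k9, max |∑ l ∈ S, min ((((sgnZ (rowT tab k l).sD (rowT tab k l).aD - (E : ℤ) : ℤ) : ℝ) / SC) * Lf l k9)
            ((((sgnZ (rowT tab k l).sD (rowT tab k l).aD + (E : ℤ) : ℤ) : ℝ) / SC) * Lf l k9)|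
          |∑ l ∈ S, max ((((sgnZ (rowT tab k l).sD (rowT tab k l).aD - (E : ℤ) : ℤ) : ℝ) / SC) * Lf l k9)
            ((((sgnZ (rowT tab k l).sD (rowT tab k l).aD + (E : ℤ) : ℤ) : ℝ) / SC) * Lf l k9)| * ρf k9 ≤
        ((gradPen E A0 A1 A2 A3 A4 A5 k a : ℕ) : ℝ) / SC ^ 2 := by
      rw [sum_fin9 (fun i j => max |∑ l ∈ S, min ((((sgnZ (rowT tab k l).sD (rowT tab k l).aD - (E : ℤ) : ℤ) : ℝ) / SC) * ((l.toLab i : ℝ) * (l.toLab j : ℝ)))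
            ((((sgnZ (rowT tab k l).sD (rowT tab k l).aD + (E : ℤ) : ℤ) : ℝ) / SC) * ((l.toLab i : ℝ) * (l.toLab j : ℝ)))|
          |∑ l ∈ S, max ((((sgnZ (rowT tab k l).sD (rowT tab k l).aD - (E : ℤ) : ℤ) : ℝ) / SC) * ((l.toLab i : ℝ) * (l.toLab j : ℝ)))
            ((((sgnZ (rowT tab k l).sD (rowT tab k l).aD + (E : ℤ) : ℤ) : ℝ) / SC) * ((l.toLab i : ℝ) * (l.toLab j : ℝ)))| * ((((g.wz i j : ℕ) : ℤ) : ℝ) / SC))]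
      simp only [Fin.sum_univ_three]
      rw [hSdef] at *
      have t00 := mul_le_mul_of_nonneg_right c00 (hw0 0 0)
      have t01 := mul_le_mul_of_nonneg_right c01 (hw0 0 1)
      have t02 := mul_le_mul_of_nonneg_right c02 (hw0 0 2)
      have t10 := mul_le_mul_of_nonneg_right c10 (hw0 1 0)
      have t11 := mul_le_mul_of_nonneg_right c11 (hw0 1 1)
      have t12 := mul_le_mul_of_nonneg_right c12 (hw0 1 2)
      have t20 := mul_le_mul_of_nonneg_right c20 (hw0 2 0)
      have t21 := mul_le_mul_of_nonneg_right c21 (hw0 2 1)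
      have t22 := mul_le_mul_of_nonneg_right c22 (hw0 2 2)
      have hgp : ((gradPen E A0 A1 A2 A3 A4 A5 k a : ℕ) : ℝ) / SC ^ 2 =
          ((absDiff a.g0P a.g0N + E * A0 : ℕ) : ℝ) / SC * ((((g.wz 0 0 : ℕ) : ℤ) : ℝ) / SC) +
          ((absDiff a.g3P a.g3N + E * A3 : ℕ) : ℝ) / SC * ((((g.wz 0 1 : ℕ) : ℤ) : ℝ) / SC) +
          ((absDiff a.g4P a.g4N + E * A4 : ℕ) : ℝ) / SC * ((((g.wz 0 2 : ℕ) : ℤ) : ℝ) / SC) +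
          (((absDiff a.g3P a.g3N + E * A3 : ℕ) : ℝ) / SC * ((((g.wz 1 0 : ℕ) : ℤ) : ℝ) / SC) +
          ((absDiff a.g1P a.g1N + E * A1 : ℕ) : ℝ) / SC * ((((g.wz 1 1 : ℕ) : ℤ) : ℝ) / SC) +
          ((absDiff a.g5P a.g5N + E * A5 : ℕ) : ℝ) / SC * ((((g.wz 1 2 : ℕ) : ℤ) : ℝ) / SC)) +
          (((absDiff a.g4P a.g4N + E * A4 : ℕ) : ℝ) / SC * ((((g.wz 2 0 : ℕ) : ℤ) : ℝ) / SC) +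
          ((absDiff a.g5P a.g5N + E * A5 : ℕ) : ℝ) / SC * ((((g.wz 2 1 : ℕ) : ℤ) : ℝ) / SC) +
          ((absDiff a.g2P a.g2N + E * A2 : ℕ) : ℝ) / SC * ((((g.wz 2 2 : ℕ) : ℤ) : ℝ) / SC)) := by
        simp only [gradPen, GB.wz, hk, GB.toLK, Nat.add_eq, Nat.mul_eq, Matrix.cons_val_zero, Matrix.cons_val_one, Matrix.cons_val_two,
          Matrix.head_cons, Matrix.tail_cons]
        push_cast
        field_simp
        ring
      rw [hgp]
      linarith [t00, t01, t02, t10, t11, t12, t20, t21, t22]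
    -- (iii-b) the entry parameters (the nine entries against the box widths): `entry_bound` per entry, `penE`
    have hH : ∀ cc bb : Fin 3, Hm a cc bb = (T.map (fun l => Dz tab k l * (nZ l cc * nZ l bb))).sum :=
      fun cc bb => Hm_sum T hTok e0 e1 e2 e3 e4 e5 cc bb
    have hANT : ∀ cc bb : Fin 3, (T.map (fun l => (nZ l cc * nZ l bb).natAbs)).sum ≤ ANt ANd ANo cc bb :=
      fun cc bb => (hsub _).trans (hAN cc bb)
    have hinner : ∀ k9' : Fin 9, ∀ l : NL, ∑ k9, Lf l k9 * Jf9 k9' k9 =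
        ((PZ e l ((@finProdFinEquiv 3 3).symm k9').1 * nZ l ((@finProdFinEquiv 3 3).symm k9').2 : ℤ) : ℝ) / SC := by
      intro k9' l
      show ∑ k9 : Fin 9, ((l.toLab ((@finProdFinEquiv 3 3).symm k9).1 : ℝ) * (l.toLab ((@finProdFinEquiv 3 3).symm k9).2 : ℝ)) *
        Jf (OfR (fun ab => (c ab : ℝ) / SC)) ((@finProdFinEquiv 3 3).symm k9') ((@finProdFinEquiv 3 3).symm k9) = _
      rw [sum_fin9 (fun i j => ((l.toLab i : ℝ) * (l.toLab j : ℝ)) * Jf (OfR (fun ab => (c ab : ℝ) / SC)) ((@finProdFinEquiv 3 3).symm k9') (i, j)),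
        sum_lab_Jf, he_def, Int.cast_mul, PZ_cast, nZ_eq, Finset.sum_mul, Finset.sum_mul, Finset.sum_div]
      refine Finset.sum_congr rfl fun cc _ => ?_
      ring
    have hEB : ∀ aa bb : Fin 3,
        max |∑ l ∈ S, min ((((sgnZ (rowT tab k l).sD (rowT tab k l).aD - (E : ℤ) : ℤ) : ℝ) / SC) * (((PZ e l aa * nZ l bb : ℤ) : ℝ) / SC))
            ((((sgnZ (rowT tab k l).sD (rowT tab k l).aD + (E : ℤ) : ℤ) : ℝ) / SC) * (((PZ e l aa * nZ l bb : ℤ) : ℝ) / SC))|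
          |∑ l ∈ S, max ((((sgnZ (rowT tab k l).sD (rowT tab k l).aD - (E : ℤ) : ℤ) : ℝ) / SC) * (((PZ e l aa * nZ l bb : ℤ) : ℝ) / SC))
            ((((sgnZ (rowT tab k l).sD (rowT tab k l).aD + (E : ℤ) : ℤ) : ℝ) / SC) * (((PZ e l aa * nZ l bb : ℤ) : ℝ) / SC))| ≤
        ((((GzM e a aa bb).natAbs + E * AEM ANd ANo e aa bb : ℕ)) : ℝ) / SC ^ 2 := by
      intro aa bb
      rw [hSdef]
      exact entry_bound (tab := tab) (k := k) (E := E) T hTnd (fun l => ((PZ e l aa * nZ l bb : ℤ) : ℝ) / SC) (fun l => PZ e l aa * nZ l bb)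
        (GzM e a aa bb) (AEM ANd ANo e aa bb) (fun l _ => rfl) (by rw [GzM]; exact G_sum e hH aa bb)
        (by rw [AEM]; exact AE_bound e (ANt ANd ANo) hANT aa bb)
    have hSK : ∑ k9', max |∑ l ∈ S, min ((((sgnZ (rowT tab k l).sD (rowT tab k l).aD - (E : ℤ) : ℤ) : ℝ) / SC) * (∑ k9, Lf l k9 * Jf9 k9' k9))
            ((((sgnZ (rowT tab k l).sD (rowT tab k l).aD + (E : ℤ) : ℤ) : ℝ) / SC) * (∑ k9, Lf l k9 * Jf9 k9' k9))|
          |∑ l ∈ S, max ((((sgnZ (rowT tab k l).sD (rowT tab k l).aD - (E : ℤ) : ℤ) : ℝ) / SC) * (∑ k9, Lf l k9 * Jf9 k9' k9))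
            ((((sgnZ (rowT tab k l).sD (rowT tab k l).aD + (E : ℤ) : ℤ) : ℝ) / SC) * (∑ k9, Lf l k9 * Jf9 k9' k9))| * hw9 k9' ≤
        ((penE E ANd ANo e a : ℕ) : ℝ) / SC ^ 3 := by
      simp only [hinner]
      rw [sum_fin9 (fun aa bb => max |∑ l ∈ S, min ((((sgnZ (rowT tab k l).sD (rowT tab k l).aD - (E : ℤ) : ℤ) : ℝ) / SC) * (((PZ e l aa * nZ l bb : ℤ) : ℝ) / SC))
            ((((sgnZ (rowT tab k l).sD (rowT tab k l).aD + (E : ℤ) : ℤ) : ℝ) / SC) * (((PZ e l aa * nZ l bb : ℤ) : ℝ) / SC))|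
          |∑ l ∈ S, max ((((sgnZ (rowT tab k l).sD (rowT tab k l).aD - (E : ℤ) : ℤ) : ℝ) / SC) * (((PZ e l aa * nZ l bb : ℤ) : ℝ) / SC))
            ((((sgnZ (rowT tab k l).sD (rowT tab k l).aD + (E : ℤ) : ℤ) : ℝ) / SC) * (((PZ e l aa * nZ l bb : ℤ) : ℝ) / SC))| * ((w (aa, bb) : ℝ) / SC))]
      rw [penE_cast, Finset.sum_div]
      refine Finset.sum_le_sum fun aa _ => ?_
      rw [Finset.sum_div]
      refine Finset.sum_le_sum fun bb _ => ?_
      have hwab : (0 : ℝ) ≤ (w (aa, bb) : ℝ) / SC := div_nonneg (by exact_mod_cast hw _) hS.le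
      refine (mul_le_mul_of_nonneg_right (hEB aa bb) hwab).trans (le_of_eq ?_)
      rw [he_def] at *
      push_cast
      rw [wM_cast c hw]
      field_simp
    -- (v) the integer inequality, scaled
    have hX : ((addP sμ aμ 0 : ℕ) : ℝ) - ((addN sμ aμ 0 : ℕ) : ℝ) = ((sgnZ sμ aμ : ℤ) : ℝ) := by exact_mod_cast addP_sub_addN sμ aμ
    have hleR : ((lhs E (addP sμ aμ 0) (gradPen E A0 A1 A2 A3 A4 A5 k a) a + 2 * penE E ANd ANo e a : ℕ) : ℝ) ≤ ((rhs (addN sμ aμ 0) a : ℕ) : ℝ) := by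
      exact_mod_cast hle
    unfold lhs rhs at hleR
    simp only [Nat.add_eq, Nat.mul_eq, SCN_eq] at hleR
    push_cast at hleR
    have key : ((sgnZ sμ aμ : ℤ) : ℝ) * (SC : ℝ) ^ 2 ≤
        2 * (((((a.vP : ℕ) : ℤ) - ((a.vN : ℕ) : ℤ) : ℤ) : ℝ) * (SC : ℝ) ^ 2 +
          ((((((a.dP : ℕ) : ℤ) - ((a.dN : ℕ) : ℤ) : ℤ) : ℝ)) - (E : ℝ) * ((a.sd : ℕ) : ℝ)) * SC -
          ((gradPen E A0 A1 A2 A3 A4 A5 k a : ℕ) : ℝ) * SC - ((penE E ANd ANo e a : ℕ) : ℝ)) - ((a.cur : ℕ) : ℝ) := by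
      rw [← hX]; push_cast; nlinarith only [hleR]
    have key' : ((sgnZ sμ aμ : ℤ) : ℝ) / SC / 2 ≤ ((((a.vP : ℕ) : ℤ) - ((a.vN : ℕ) : ℤ) : ℤ) : ℝ) / SC +
        ((((((a.dP : ℕ) : ℤ) - ((a.dN : ℕ) : ℤ) : ℤ) : ℝ)) - (E : ℝ) * ((a.sd : ℕ) : ℝ)) / SC ^ 2 -
        ((gradPen E A0 A1 A2 A3 A4 A5 k a : ℕ) : ℝ) / SC ^ 2 - ((penE E ANd ANo e a : ℕ) : ℝ) / SC ^ 3 - 1 / 2 * (((a.cur : ℕ) : ℝ) / SC ^ 3) := by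
      have h3 : (0:ℝ) < 2 * (SC : ℝ) ^ 3 := by positivity
      have := div_le_div_of_nonneg_right key h3.le
      calc ((sgnZ sμ aμ : ℤ) : ℝ) / SC / 2 = ((sgnZ sμ aμ : ℤ) : ℝ) * (SC : ℝ) ^ 2 / (2 * (SC : ℝ) ^ 3) := by field_simp
        _ ≤ _ := this
        _ = _ := by field_simp
    rw [hSV, hSD]
    have hcur := mul_le_mul_of_nonneg_left hSC (by norm_num : (0:ℝ) ≤ 1 / 2)
    linarith only [hSG, hSK, key', hcur]
  -- from the S-sum to the box sum (verbatim tail with the param far lemma)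
  have hsumS : ∑ l ∈ S, effPot w₄₅ ω₄ (3 / 400) (Real.sqrt (∑ k9, Lf l k9 * cf k9)) = ∑ l ∈ S, effPot w₄₅ ω₄ (3 / 400) ‖latPt U fccVec l.toLab‖ := by
    refine Finset.sum_congr rfl fun l _ => ?_
    have e := summand_eq_gram (effPot w₄₅ ω₄ (3 / 400)) U fccVec l.toLab
    exact e.symm
  rw [hsumS] at hmain
  have hinj : Set.InjOn NL.toLab ↑S := by
    intro l hl l' hl' hll
    have hl1 : l ∈ labs := hTmem l ((hmemS l).1 hl)
    have hl2 : l' ∈ labs := hTmem l' ((hmemS l').1 hl')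
    exact (List.inj_on_of_nodup_map hnd) hl1 hl2 hll
  have himg : ∑ b ∈ S.image NL.toLab, effPot w₄₅ ω₄ (3 / 400) ‖latPt U fccVec b‖ = ∑ l ∈ S, effPot w₄₅ ω₄ (3 / 400) ‖latPt U fccVec l.toLab‖ :=
    Finset.sum_image hinj
  have hfold := sum_box7_eq_two_mul_sum (S.image NL.toLab) (fun b => effPot w₄₅ ω₄ (3 / 400) ‖latPt U fccVec b‖)
    (fun b hb => by
      obtain ⟨l, hl, rfl⟩ := Finset.mem_image.1 hb
      exact hbox7 l (hTmem l ((hmemS l).1 hl)))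
    (fun b hb hnb => by
      obtain ⟨l, hl, rfl⟩ := Finset.mem_image.1 hb
      obtain ⟨l', hl', hll'⟩ := Finset.mem_image.1 hnb
      exact hcanon l (hTmem l ((hmemS l).1 hl)) l' (hTmem l' ((hmemS l').1 hl')) (by simp [hll']))
    (fun b => by rw [norm_latPt_neg])
    (fun b hb h1 h2 => by
      refine effPot45_eq_far ?_
      rcases hcov b hb with ⟨l, hl, hlb⟩ | hfar
      · by_cases hv : l ∈ visited nstop labs
        · have hs := hall l hv
          by_cases ht : treatedR tab k r l = true
          · have hlS : l ∈ S := (hmemS l).2 (List.mem_filter.2 ⟨hv, by simpa using ht⟩)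
            rcases hlb with hlb | hlb
            · exact absurd (Finset.mem_image.2 ⟨l, hlS, hlb⟩) h1
            · exact absurd (Finset.mem_image.2 ⟨l, hlS, by simp [hlb]⟩) h2
          · obtain ⟨hq, hfb⟩ := farBR_of_untreated hs (by simpa using ht)
            have := far_of_farBP U hcen hbox (hok l hl) hq hfb
            rcases hlb with hlb | hlb
            · rwa [hlb] at this
            · rw [← norm_latPt_neg, ← hlb] ; exact this
        · have := hstop l hl hv
          rcases hlb with hlb | hlb
          · rwa [hlb] at this
          · rw [← norm_latPt_neg, ← hlb]; exact this
      · exact hfar)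
  rw [hfold, himg]
  linarith

end Summit.AtomisticToContinuum.Crystallization.Theorems.FrustratedLawDichotomyStrainedPatchHomLeafTableCheck

end
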